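import Literature.Probability.LatticeModels.HalfPlaneClusterSides
import HarnessLib

/-!
# The last axis site of the infinite `+∗`cluster exists almost surely (Georgii–Higuchi 2000, §5)

Topic `Probability/LatticeModels`; theorems only. In the coexistence situation of Georgii–Higuchi
2000, §5 (an infinite `+∗`cluster and an infinite `-`cluster of the upper half-plane; proof of
Lemma 5.3 and of Lemma 5.4, where the statistic `a_n = max{k : (k, n) ∈ I^{+∗}_{π_{n,up}}}` is used), we
show that the statistic is well defined: **almost surely there is an integer `a` such that some infinite
`+∗`cluster of the upper half-plane has an axis site of abscissa `≥ a` but none has one of abscissa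
`≥ a + 1`** (`ae_exists_lastAxisSite`), provided the infinite `+∗`cluster touches the axis on the left
outside every box (the orientation "`+`face on the left", a tail event by `OrientationTail`); and the
mirror statement for the orientation "`+`face on the right" (`ae_exists_firstAxisSite`). We also record
the **dichotomy of the two orientations** (`ae_axisUnboundedBelow_or_above`). Inputs: uniqueness and
sides (`HalfPlaneClusterSides`) and the line touching lemma.

## References

* H.-O. Georgii, Y. Higuchi, J. Math. Phys. 41 (2000) 1153–1169, proofs of Lemma 5.3 (p. 13) and
  Lemma 5.4 (p. 14) [GeorgiiHiguchi2000].
-/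

noncomputable section

open MeasureTheory Filter SimpleGraph
open Literature.Probability.Percolation
open scoped ENNReal

namespace Literature.Probability.LatticeModels

section Deterministic

variable {ω : SpinConfig (Site 2)}

/-- A cluster with axis sites outside every box is infinite. [folklore] -/
theorem infinite_of_axis_unbounded_below {G : SimpleGraph (Site 2)} {O : Set (Site 2)} {x : Site 2}
    (h : ∀ n : ℕ, ∃ k : ℤ, k < -(n : ℤ) ∧ (![k, 0] : Site 2) ∈ siteCluster G O x) : (siteCluster G O x).Infinite := by
  intro hfin
  obtain ⟨H, hH⟩ := (eventually_subset_box_holds (d := 2) hfin.toFinset).exists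
  obtain ⟨k, hk, hmem⟩ := h H
  have := hH ((Set.Finite.mem_toFinset hfin).2 hmem)
  rw [mem_box, Fin.forall_fin_two] at this
  simp at this; omega

/-- A cluster with axis sites outside every box is infinite. [folklore] -/
theorem infinite_of_axis_unbounded_above {G : SimpleGraph (Site 2)} {O : Set (Site 2)} {x : Site 2}
    (h : ∀ n : ℕ, ∃ k : ℤ, (n : ℤ) < k ∧ (![k, 0] : Site 2) ∈ siteCluster G O x) : (siteCluster G O x).Infinite := by
  intro hfin
  obtain ⟨H, hH⟩ := (eventually_subset_box_holds (d := 2) hfin.toFinset).exists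
  obtain ⟨k, hk, hmem⟩ := h H
  have := hH ((Set.Finite.mem_toFinset hfin).2 hmem)
  rw [mem_box, Fin.forall_fin_two] at this
  simp at this; omega

/-- **The last axis site** (deterministic form): if the infinite `+∗`clusters of the upper half-plane
all coincide, one of them has axis sites unbounded below, and an infinite `-`cluster with an axis
site lies to their right, then for some integer `a` the site `(a, 0)` lies in an infinite `+∗`cluster
and no `(k, 0)` with `k ≥ a + 1` does. [cite: GeorgiiHiguchi2000, Lemma 5.4 (proof, p. 14)] -/
theorem exists_lastAxisSite {x y : Site 2}
    (huniq : ∀ x₁ x₂ : Site 2, (siteCluster zdStarGraph (spinSites 1 ω ∩ halfPlane 0) x₁).Infinite →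
      (siteCluster zdStarGraph (spinSites 1 ω ∩ halfPlane 0) x₂).Infinite →
      siteCluster zdStarGraph (spinSites 1 ω ∩ halfPlane 0) x₁ = siteCluster zdStarGraph (spinSites 1 ω ∩ halfPlane 0) x₂)
    (hL : ∀ n : ℕ, ∃ k : ℤ, k < -(n : ℤ) ∧ (![k, 0] : Site 2) ∈ siteCluster zdStarGraph (spinSites 1 ω ∩ halfPlane 0) x)
    (hside : ∀ a k : ℤ, (![a, 0] : Site 2) ∈ siteCluster zdStarGraph (spinSites 1 ω ∩ halfPlane 0) x →
      (![k, 0] : Site 2) ∈ siteCluster (zdGraph 2) (spinSites (-1) ω ∩ halfPlane 0) y → a < k)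
    (hC0 : ∃ k : ℤ, (![k, 0] : Site 2) ∈ siteCluster (zdGraph 2) (spinSites (-1) ω ∩ halfPlane 0) y) :
    ∃ a : ℤ, (siteCluster zdStarGraph (spinSites 1 ω ∩ halfPlane 0) ![a, 0]).Infinite ∧
      ∀ k : ℤ, a + 1 ≤ k → ¬ (siteCluster zdStarGraph (spinSites 1 ω ∩ halfPlane 0) ![k, 0]).Infinite := by
  set D := siteCluster zdStarGraph (spinSites 1 ω ∩ halfPlane 0) x with hDdef
  have hDinf : D.Infinite := infinite_of_axis_unbounded_below hL
  obtain ⟨k₀, hk₀⟩ := hC0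
  -- the axis sites of `D`, a nonempty set of integers bounded above by `k₀`
  obtain ⟨k₁, -, hk₁⟩ := hL 0
  obtain ⟨a, haD, hamax⟩ := Int.exists_greatest_of_bdd (P := fun a : ℤ => (![a, 0] : Site 2) ∈ D)
    ⟨k₀, fun a ha => (hside a k₀ ha hk₀).le⟩ ⟨k₁, hk₁⟩
  refine ⟨a, ?_, fun k hk hinf => ?_⟩
  · have hself : (![a, 0] : Site 2) ∈ siteCluster zdStarGraph (spinSites 1 ω ∩ halfPlane 0) ![a, 0] :=
      (mem_siteCluster_self_iff _ _ _).2 haD.2.1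
    rw [siteCluster_eq_of_mem hself haD]; exact hDinf
  · have heq := huniq _ _ hinf hDinf
    have hkD : (![k, 0] : Site 2) ∈ D := by
      have hself : (![k, 0] : Site 2) ∈ siteCluster zdStarGraph (spinSites 1 ω ∩ halfPlane 0) ![k, 0] :=
        (mem_siteCluster_self_iff _ _ _).2 (hinf.nonempty.some_mem.1)
      rw [heq] at hself; exact hself
    have := hamax k hkD
    omega

/-- **The first axis site** (mirror form, orientation "`+`face on the right"). [cite: GeorgiiHiguchi2000, Lemma 5.4 (proof, p. 14)] -/
theorem exists_firstAxisSite {x y : Site 2}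
    (huniq : ∀ x₁ x₂ : Site 2, (siteCluster zdStarGraph (spinSites 1 ω ∩ halfPlane 0) x₁).Infinite →
      (siteCluster zdStarGraph (spinSites 1 ω ∩ halfPlane 0) x₂).Infinite →
      siteCluster zdStarGraph (spinSites 1 ω ∩ halfPlane 0) x₁ = siteCluster zdStarGraph (spinSites 1 ω ∩ halfPlane 0) x₂)
    (hR : ∀ n : ℕ, ∃ k : ℤ, (n : ℤ) < k ∧ (![k, 0] : Site 2) ∈ siteCluster zdStarGraph (spinSites 1 ω ∩ halfPlane 0) x)
    (hside : ∀ a k : ℤ, (![a, 0] : Site 2) ∈ siteCluster zdStarGraph (spinSites 1 ω ∩ halfPlane 0) x →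
      (![k, 0] : Site 2) ∈ siteCluster (zdGraph 2) (spinSites (-1) ω ∩ halfPlane 0) y → k < a)
    (hC0 : ∃ k : ℤ, (![k, 0] : Site 2) ∈ siteCluster (zdGraph 2) (spinSites (-1) ω ∩ halfPlane 0) y) :
    ∃ a : ℤ, (siteCluster zdStarGraph (spinSites 1 ω ∩ halfPlane 0) ![a, 0]).Infinite ∧
      ∀ k : ℤ, k ≤ a - 1 → ¬ (siteCluster zdStarGraph (spinSites 1 ω ∩ halfPlane 0) ![k, 0]).Infinite := by
  set D := siteCluster zdStarGraph (spinSites 1 ω ∩ halfPlane 0) x with hDdef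
  have hDinf : D.Infinite := infinite_of_axis_unbounded_above hR
  obtain ⟨k₀, hk₀⟩ := hC0
  obtain ⟨k₁, -, hk₁⟩ := hR 0
  obtain ⟨a, haD, hamin⟩ := Int.exists_least_of_bdd (P := fun a : ℤ => (![a, 0] : Site 2) ∈ D)
    ⟨k₀, fun a ha => (hside a k₀ ha hk₀).le⟩ ⟨k₁, hk₁⟩
  refine ⟨a, ?_, fun k hk hinf => ?_⟩
  · have hself : (![a, 0] : Site 2) ∈ siteCluster zdStarGraph (spinSites 1 ω ∩ halfPlane 0) ![a, 0] :=
      (mem_siteCluster_self_iff _ _ _).2 haD.2.1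
    rw [siteCluster_eq_of_mem hself haD]; exact hDinf
  · have heq := huniq _ _ hinf hDinf
    have hkD : (![k, 0] : Site 2) ∈ D := by
      have hself : (![k, 0] : Site 2) ∈ siteCluster zdStarGraph (spinSites 1 ω ∩ halfPlane 0) ![k, 0] :=
        (mem_siteCluster_self_iff _ _ _).2 (hinf.nonempty.some_mem.1)
      rw [heq] at hself; exact hself
    have := hamin k hkD
    omega

end Deterministic

section AlmostSure

variable {β : ℝ} {μ : Measure (SpinConfig (Site 2))}

/-- **Dichotomy of the orientations**: for `β > β_c(2)` and `μ ∈ 𝒢(β, 0)`, almost surely every infinite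
`+∗`cluster of the upper half-plane has axis sites unbounded below or axis sites unbounded above (line
touching outside every box). [cite: GeorgiiHiguchi2000, Lemma 4.1] -/
theorem ae_axisUnbounded_below_or_above (hβc : criticalBeta 2 < β) (hμ : μ ∈ isingGibbsMeasures 2 β 0) :
    ∀ᵐ ω ∂μ, ∀ x, (siteCluster zdStarGraph (spinSites 1 ω ∩ halfPlane 0) x).Infinite →
      (∀ n : ℕ, ∃ k : ℤ, k < -(n : ℤ) ∧ (![k, 0] : Site 2) ∈ siteCluster zdStarGraph (spinSites 1 ω ∩ halfPlane 0) x) ∨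
      (∀ n : ℕ, ∃ k : ℤ, (n : ℤ) < k ∧ (![k, 0] : Site 2) ∈ siteCluster zdStarGraph (spinSites 1 ω ∩ halfPlane 0) x) := by
  filter_upwards [ae_infinite_cluster_touches_axis_io (G := zdStarGraph) hβc zdGraph_le_zdStarGraph le_rfl hμ] with ω hD x hDx
  by_contra h
  push Not at h
  obtain ⟨⟨n₁, hn₁⟩, ⟨n₂, hn₂⟩⟩ := h
  obtain ⟨a, ha, han⟩ := exists_axis_far (hD x hDx) (n₁ + n₂)
  rcases abs_cases a with ⟨h1, h2⟩ | ⟨h1, h2⟩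
  · exact hn₂ a (by push_cast at han; omega) ha
  · exact hn₁ a (by push_cast at han; omega) ha

/-- **The last axis site exists almost surely** (orientation "`+`face on the left"): for `β > β_c(2)`
and `μ ∈ 𝒢(β, 0)`, almost surely, if some infinite `+∗`cluster of the upper half-plane has axis sites
unbounded below and an infinite `-`cluster of the upper half-plane exists, then for some integer `j`
some infinite `+∗`cluster has an axis site of abscissa `≥ j` and none has one of abscissa `≥ j + 1`
(the hypothesis of `MaxAxisComparison.le_measure_axisReach_shift`). [cite: GeorgiiHiguchi2000, Lemma 5.4 (proof, p. 14)] -/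
theorem ae_exists_lastAxisSite (hβc : criticalBeta 2 < β) (hμ : μ ∈ isingGibbsMeasures 2 β 0) :
    ∀ᵐ ω ∂μ, (∃ x, ∀ n : ℕ, ∃ k : ℤ, k < -(n : ℤ) ∧ (![k, 0] : Site 2) ∈ siteCluster zdStarGraph (spinSites 1 ω ∩ halfPlane 0) x) →
      (∃ y, (siteCluster (zdGraph 2) (spinSites (-1) ω ∩ halfPlane 0) y).Infinite) →
      ∃ j : ℤ, ω ∈ {ω : SpinConfig (Site 2) | ∃ k : ℤ, j ≤ k ∧
          (siteCluster zdStarGraph (spinSites 1 ω ∩ halfPlane 0) ![k, 0]).Infinite} \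
        {ω | ∃ k : ℤ, j + 1 ≤ k ∧ (siteCluster zdStarGraph (spinSites 1 ω ∩ halfPlane 0) ![k, 0]).Infinite} := by
  filter_upwards [ae_plusStar_cluster_unique hβc hμ, ae_plusStar_minus_sides hβc hμ,
    ae_minus_touches_axis_io (G := zdGraph 2) hβc le_rfl zdGraph_le_zdStarGraph hμ] with ω huniq hsides hCt ⟨x, hL⟩ ⟨y, hCy⟩
  have hDinf := infinite_of_axis_unbounded_below hL
  obtain ⟨k₀, hk₀, -⟩ := exists_axis_far (hCt y hCy) 0
  -- the orientation is "left": the other one contradicts `hL`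
  have hside : ∀ a k : ℤ, (![a, 0] : Site 2) ∈ siteCluster zdStarGraph (spinSites 1 ω ∩ halfPlane 0) x →
      (![k, 0] : Site 2) ∈ siteCluster (zdGraph 2) (spinSites (-1) ω ∩ halfPlane 0) y → a < k := by
    rcases hsides x y hDinf hCy with h | h
    · exact h
    · exfalso
      obtain ⟨a, han, ha⟩ := hL k₀.natAbs
      have := h a k₀ ha hk₀
      omega
  obtain ⟨a, ha, hno⟩ := exists_lastAxisSite (fun x₁ x₂ h₁ h₂ => huniq x₁ x₂ y h₁ h₂ hCy) hL hside ⟨k₀, hk₀⟩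
  exact ⟨a, ⟨a, le_rfl, ha⟩, fun ⟨k, hk, hinf⟩ => hno k hk hinf⟩

/-- **The first axis site exists almost surely** (orientation "`+`face on the right"). [cite: GeorgiiHiguchi2000, Lemma 5.4 (proof, p. 14)] -/
theorem ae_exists_firstAxisSite (hβc : criticalBeta 2 < β) (hμ : μ ∈ isingGibbsMeasures 2 β 0) :
    ∀ᵐ ω ∂μ, (∃ x, ∀ n : ℕ, ∃ k : ℤ, (n : ℤ) < k ∧ (![k, 0] : Site 2) ∈ siteCluster zdStarGraph (spinSites 1 ω ∩ halfPlane 0) x) →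
      (∃ y, (siteCluster (zdGraph 2) (spinSites (-1) ω ∩ halfPlane 0) y).Infinite) →
      ∃ j : ℤ, ω ∈ {ω : SpinConfig (Site 2) | ∃ k : ℤ, k ≤ j ∧
          (siteCluster zdStarGraph (spinSites 1 ω ∩ halfPlane 0) ![k, 0]).Infinite} \
        {ω | ∃ k : ℤ, k ≤ j - 1 ∧ (siteCluster zdStarGraph (spinSites 1 ω ∩ halfPlane 0) ![k, 0]).Infinite} := by
  filter_upwards [ae_plusStar_cluster_unique hβc hμ, ae_plusStar_minus_sides hβc hμ,
    ae_minus_touches_axis_io (G := zdGraph 2) hβc le_rfl zdGraph_le_zdStarGraph hμ] with ω huniq hsides hCt ⟨x, hR⟩ ⟨y, hCy⟩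
  have hDinf := infinite_of_axis_unbounded_above hR
  obtain ⟨k₀, hk₀, -⟩ := exists_axis_far (hCt y hCy) 0
  have hside : ∀ a k : ℤ, (![a, 0] : Site 2) ∈ siteCluster zdStarGraph (spinSites 1 ω ∩ halfPlane 0) x →
      (![k, 0] : Site 2) ∈ siteCluster (zdGraph 2) (spinSites (-1) ω ∩ halfPlane 0) y → k < a := by
    rcases hsides x y hDinf hCy with h | h
    · exfalso
      obtain ⟨a, han, ha⟩ := hR k₀.natAbs
      have := h a k₀ ha hk₀
      omega
    · exact h
  obtain ⟨a, ha, hno⟩ := exists_firstAxisSite (fun x₁ x₂ h₁ h₂ => huniq x₁ x₂ y h₁ h₂ hCy) hR hside ⟨k₀, hk₀⟩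
  exact ⟨a, ⟨a, le_rfl, ha⟩, fun ⟨k, hk, hinf⟩ => hno k hk hinf⟩

end AlmostSure

end Literature.Probability.LatticeModels
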